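import Summits.BirchSwinnertonDyer.BirchSwinnertonDyer.Theorems.ClassRecordThreeCornerTwistWitnessExactTwin
import Literature.NumberTheory.QuadraticFields.FundamentalDiscriminant
import Literature.NumberTheory.QuadraticFields.ImaginaryQuadraticPrescribedSplitting
import Literature.NumberTheory.EllipticCurves.HeegnerHypothesisKroneckerProofs
import Literature.NumberTheory.EllipticCurves.ModularityVersionApProofs
import Literature.NumberTheory.EllipticCurves.OrdinaryPrimesProofs
import HarnessLib

/-!
# Route `ClassRecordThree` (rung K2@3), crux `CornerAtThreeW` (item stmt-BirchSwinnertonDyer-21420), aside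
# `CornerTwistWitnessLeafAtThree` (item 21421): BC5 RUNGS for the witness conjunct `CornerTwistWitnessAt W`
# at CERTIFIED (pair, twin) rows of the D-h census (cell `bsd-stepL`, seat `bsd-stepL-mult-p3` g5;
# `--supports stmt-BirchSwinnertonDyer-21421`)

HONEST FRAMING. BSD is not proved by any of this; a rung is ONE curve and closes nothing; `CornerTwistWitnessLeafAtThree`
(the conjunct for EVERY corner curve) is asserted nowhere. THEOREMS ONLY (0 defs, 0 named facts, 0 `sorry`).

WHAT IS KERNEL AND WHAT IS ATTESTED. The predicate `CornerTwistWitness.CornerTwistWitnessAt W` (p556532) asks, for a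
corner curve `W` (`ClassX11b W 3`, `ρ̄_{E,3}` not onto), for SOME imaginary quadratic `K` with `d_K` odd, `d_K < -4`,
Heegner for `N_E` and for `3`, `L(E^{d_K},1) ≠ 0`, and a global minimal model `Wd = Cd • E^{(d_K)}` with `BSDp Wd 3`.
The master theorem `cornerTwistWitnessAt_of_certifiedTwin` discharges IN THE KERNEL, from integer data of one row
`(E, d, Wd, Cd)`: the EXISTENCE of the field `K = ℚ(√d)` (the tree's `Quadratic.exists_numberField_discr_eq`), that it
is imaginary quadratic with `d_K = d` odd and `< -4`, BOTH Heegner hypotheses (decomposition law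
`satisfiesHeegnerHypothesis_iff_kronecker` — for `N_E` through `p ∣ N_E ⇒ ¬ good reduction at p ⇒ p ∣ Δ_min(E)`
(`dvd_conductorNorm_iff_not_hasGoodReductionAtPrime`, `hasGoodReductionAtPrime_of_not_dvd`), so only the prime
factors of the INTEGER `Δ(W)` and the Kronecker symbols `(d/p)` are needed, never the conductor), and the twist-model
identity `Cd • W.quadraticTwist d = Wd` (ring arithmetic). `BSDp Wd 3` then comes from g4's t0 engine
`bsdp_twin_of_shaAn_unit_of_not_dvd_tamagawaProduct` (p561944). What stays ATTESTED per row (hypotheses, reproducible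
outside, NOT kernel-checked): the two analytic numbers of the census row — `L(E^d,1) ≠ 0` and `#Ш_an(E^d)` a
positive `3`-adic unit (kit j289043, engines PARI `ellL1`∕`ellbsd` at 38 and 77 digits and `lfun`) —, the curve-level
binders `¬ 3 ∣ ∏_ℓ c_ℓ(E)` (t0 cell) and the global minimality of the two integer models (Cremona ∕ Tate), exactly as in
the cell's other BC5 rungs (`KolyvaginRoadThreeRung347253a1`, `ClassRecordThreeRegCertRows*`). The thirteen PUBLISHED
inputs of the engine (Kato 2004, Skinner–Urban via Stein–Wuthrich Thm 6.1, GZK, modularity, Greenberg–Stevens,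
Greenberg 1999, Wuthrich 2014) stay binders.

PARTITION: O2@3 (B10) × T4″ corner, t0 cell (`3 ∤ ∏c`, 88 pairs N < 5·10⁵) × crux `CornerAtThreeW` witness conjunct —
types-the-object-of (BC5 rungs); closes: none (T7).

References (locators only): [cite: Miller2011LMS, Def. 1.1 (arXiv:1010.2431 p. 3)] [cite: Kato2004Asterisque, §17.13]
[cite: SteinWuthrich2013, Thm. 6.1] [cite: Wuthrich2014, Cor. 18] [cite: Marcus2018, Ch. 3 Thm. 25 (decomposition law)]
[cite: SilvermanAEC2009, VII.5 Prop. 5.1 (a)].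
-/

open scoped Classical NumberField

-- the cell's Theorems namespace repeats the summit name (Summit.<Summit>.<Problem>), as in every sibling file
set_option linter.dupNamespace false

namespace Summit.BirchSwinnertonDyer.BirchSwinnertonDyer.Theorems.CornerTwistWitness

open WeierstrassCurve NumberField IsDedekindDomain Field
  Literature.NumberTheory.EllipticCurves
  Literature.NumberTheory.EllipticCurves.ModularForms
  Literature.NumberTheory.EllipticCurves.Rank1Residual
  Literature.NumberTheory.EllipticCurves.Rank1Residual.Typed
  Literature.NumberTheory.EllipticCurves.Wuthrich2014
  Literature.NumberTheory.EllipticCurves.SteinWuthrich2013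
  Literature.NumberTheory.EllipticCurves.Greenberg1999
  Literature.NumberTheory.EllipticCurves.Kato2004
  Literature.NumberTheory.QuadraticFields.Quadratic
  Summit.BirchSwinnertonDyer.Rank1Residual
  Summit.BirchSwinnertonDyer.Rank1Residual.X11b
  Summit.BirchSwinnertonDyer.Rank1Residual.X11b.Three

/-! ## §0 Kernel lemmas: the prime support of the conductor, and the Heegner hypotheses from Kronecker symbols -/

/-- **A prime dividing the conductor divides the minimal discriminant**: `p ∣ N_E ⇒ E` has bad reduction at `p`
(`dvd_conductorNorm_iff_not_hasGoodReductionAtPrime`) `⇒ p ∣ Δ_min(E)` (Silverman VII.5.1 (a), contrapositive of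
`hasGoodReductionAtPrime_of_not_dvd`). [cite: SilvermanAEC2009, VII.5 Prop. 5.1 (a)] -/
theorem dvd_minimalDiscriminantInt_of_dvd_conductorNorm (W : WeierstrassCurve ℚ) [W.IsElliptic] [W.IsGloballyMinimal]
    {p : ℕ} (hp : p.Prime) (hpN : p ∣ W.conductorNorm ℤ) : (p : ℤ) ∣ minimalDiscriminantInt W := by
  haveI : Fact p.Prime := ⟨hp⟩
  by_contra h
  exact (W.dvd_conductorNorm_iff_not_hasGoodReductionAtPrime p).mp hpN (W.hasGoodReductionAtPrime_of_not_dvd p h)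

/-- **The Heegner hypothesis for `N_E` from Kronecker symbols at the prime factors of `Δ(W)`**: if `W` is globally
minimal with `Δ(W) = Δ₀ ∈ ℤ`, `K` is quadratic with `d_K = d`, and every prime `p ∣ Δ₀` has `(d/p) = 1` (`d ≡ 1 (mod 8)`
at `p = 2`), then every prime dividing `N_E` splits in `K`. The conductor itself is never evaluated.
[cite: Marcus2018, Ch. 3 Thm. 25 (decomposition law)] [cite: SilvermanAEC2009, VII.5 Prop. 5.1 (a)] -/
theorem satisfiesHeegnerHypothesis_conductorNorm_of_kronecker (W : WeierstrassCurve ℚ) [W.IsElliptic]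
    [W.IsGloballyMinimal] (K : Type) [Field K] [NumberField K] (h2 : Module.finrank ℚ K = 2) {d Δ₀ : ℤ}
    (hdK : NumberField.discr K = d) (hΔ : W.Δ = (Δ₀ : ℚ))
    (hH : ∀ p : ℕ, p.Prime → p ∣ Δ₀.natAbs → (p = 2 → d % 8 = 1) ∧ (p ≠ 2 → jacobiSym d p = 1)) :
    SatisfiesHeegnerHypothesis (W.conductorNorm ℤ) K := by
  rw [satisfiesHeegnerHypothesis_iff_kronecker _ K h2, hdK]
  intro p hp hpN
  refine hH p hp ?_
  have h1 := dvd_minimalDiscriminantInt_of_dvd_conductorNorm W hp hpN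
  have h2 : minimalDiscriminantInt W = Δ₀ := by
    have := cast_minimalDiscriminantInt W
    rw [hΔ] at this
    exact_mod_cast this
  rw [h2] at h1
  exact Int.natCast_dvd.mp h1

/-- **The Heegner hypothesis for the prime `3`** from `(d/3) = 1`. [cite: Marcus2018, Ch. 3 Thm. 25 (decomposition law)] -/
theorem satisfiesHeegnerHypothesis_three_of_kronecker (K : Type) [Field K] [NumberField K]
    (h2 : Module.finrank ℚ K = 2) {d : ℤ} (hdK : NumberField.discr K = d) (h3 : jacobiSym d 3 = 1) :
    SatisfiesHeegnerHypothesis 3 K := by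
  rw [satisfiesHeegnerHypothesis_iff_kronecker 3 K h2, hdK]
  intro p hp hp3
  have hp' : p = 3 := (Nat.prime_dvd_prime_iff_eq hp Nat.prime_three).mp hp3
  subst hp'
  exact ⟨fun h ↦ absurd h (by decide), fun _ ↦ h3⟩

/-- **An analytic-Sha certificate in the engine's shape**: `#Ш_an(Wd) = n` with `n` a positive integer prime to `3` gives the
`∃ q ≠ 0, #Ш_an = q ∧ ord₃ q = 0` package of `bsdp_twin_of_shaAn_unit_of_not_dvd_tamagawaProduct`. Bookkeeping.
[cite: Miller2011LMS, Def. 1.1 (arXiv:1010.2431 p. 3)] -/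
theorem shaAn_cert_of_eq_nat (Wd : WeierstrassCurve ℚ) {n : ℕ} (hn : n ≠ 0) (h3 : ¬ 3 ∣ n)
    (h : shaAn Wd = (n : ℂ)) : ∃ q : ℚ, q ≠ 0 ∧ shaAn Wd = (q : ℂ) ∧ padicValRat 3 q = 0 := by
  refine ⟨n, by exact_mod_cast hn, by rw [h]; norm_cast, ?_⟩
  rw [padicValRat.of_nat]
  exact_mod_cast padicValNat.eq_zero_of_not_dvd h3

/-! ## §1 The master rung: `CornerTwistWitnessAt W` from ONE certified odd Heegner twin on the t0 cell -/

/-- **`CornerTwistWitnessAt W` from one certified row `(E, d, Wd, Cd)`** — t0 cell (`3 ∤ ∏c(E)`). KERNEL: the field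
`K = ℚ(√d)` exists and is imaginary quadratic with `d_K = d` odd `< -4`; Heegner for `N_E` (via `Δ(W)`'s prime factors)
and for `3`; the twist-model identity is an input equation checked by the caller with `norm_num`. ENGINE: g4's
`bsdp_twin_of_shaAn_unit_of_not_dvd_tamagawaProduct` (thirteen published binders). ATTESTED (hypotheses): `L(E^d,1) ≠ 0`,
`#Ш_an(Wd)` a non-zero `3`-adic unit, `3 ∤ ∏c(E)`, global minimality of `W` and `Wd`. CONDITIONAL on every binder;
nothing booked. [cite: Miller2011LMS, Def. 1.1] [cite: Kato2004Asterisque, §17.13] [cite: SteinWuthrich2013, Thm. 6.1]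
[cite: Marcus2018, Ch. 3 Thm. 25] -/
theorem cornerTwistWitnessAt_of_certifiedTwin
    (hJs : thm61_splitMultiplicative) (hJn : thm61_nonsplitMultiplicative)
    (hGZK : rank_eq_analyticRank_of_analyticRank_le_one) (hmod : hasEntireLFunction_rat)
    (hpar : nonempty_modularParametrizationData)
    (hGS : ∀ (W : WeierstrassCurve ℚ) [W.IsElliptic] [W.IsGloballyMinimal] (p : ℕ) [Fact p.Prime],
      greenberg_stevens (W := W) (p := p))
    (hne : Kato2004.nonempty_iwasawaH1Data) (h12 : Kato2004.thm12_4)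
    (hns : Kato2004.exists_multDivisibilityInputs_nonsplit)
    (hsp : Kato2004.exists_multDivisibilityInputs_split)
    (h15 : thm15_isTorsion_multiplicative_rat)
    (h18 : Wuthrich2014.corollary18_padicLFunction_mem_iwasawaAlgebra_multiplicative)
    (hfine : Kato2004.exists_multDivisibilityInputs_fine)
    (W : WeierstrassCurve ℚ) [W.IsElliptic] [W.IsGloballyMinimal]
    -- the row's discriminant `d` (negative odd fundamental) and the integer `Δ(W)`
    {d Δ₀ : ℤ} (hd4 : d % 4 = 1) (hsf : Squarefree d) (hlt : d < -4) (hΔ : W.Δ = (Δ₀ : ℚ))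
    (hH : ∀ p : ℕ, p.Prime → p ∣ Δ₀.natAbs → (p = 2 → d % 8 = 1) ∧ (p ≠ 2 → jacobiSym d p = 1))
    (h3 : jacobiSym d 3 = 1)
    -- attested curve-level binder: the t0 cell
    (ht0 : ¬ 3 ∣ W.tamagawaProduct)
    -- the twin's global minimal model and the change of variables from the tree's twist model (kernel-checked by the caller)
    (Wd : WeierstrassCurve ℚ) [Wd.IsElliptic] [Wd.IsGloballyMinimal] (Cd : VariableChange ℚ)
    (hWd : Cd • W.quadraticTwist (d : ℚ) = Wd)
    -- attested analytic row: `L(E^d,1) ≠ 0` and `#Ш_an(E^d)` a non-zero 3-adic unit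
    (hLt : (W.quadraticTwist (d : ℚ)).entireLFunction 1 ≠ 0)
    (hsha : ∃ q : ℚ, q ≠ 0 ∧ shaAn Wd = (q : ℂ) ∧ padicValRat 3 q = 0) :
    CornerTwistWitnessAt W := by
  intro hX hnsj
  obtain ⟨K, _, _, h2, hdK⟩ :=
    Literature.NumberTheory.QuadraticFields.Quadratic.exists_numberField_discr_eq (D := d)
      (Or.inl ⟨hd4, hsf, by omega⟩)
  have hK : IsImaginaryQuadratic K :=
    ⟨h2, Literature.NumberTheory.QuadraticFields.Quadratic.isTotallyComplex_of_discr_neg h2 (by rw [hdK]; omega)⟩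
  have hodd : Odd (NumberField.discr K) := by
    rw [hdK, Int.odd_iff]; omega
  have hHN : SatisfiesHeegnerHypothesis (W.conductorNorm ℤ) K :=
    satisfiesHeegnerHypothesis_conductorNorm_of_kronecker W K h2 hdK hΔ hH
  have hH3 : SatisfiesHeegnerHypothesis 3 K := satisfiesHeegnerHypothesis_three_of_kronecker K h2 hdK h3
  have hdq : (NumberField.discr K : ℚ) = (d : ℚ) := by exact_mod_cast hdK
  have hLt' : (W.quadraticTwist (NumberField.discr K : ℚ)).entireLFunction 1 ≠ 0 := by rw [hdq]; exact hLt
  have hWd' : Cd • W.quadraticTwist (NumberField.discr K : ℚ) = Wd := by rw [hdq]; exact hWd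
  have hbsd : BSDp Wd 3 :=
    bsdp_twin_of_shaAn_unit_of_not_dvd_tamagawaProduct hJs hJn hGZK hmod hpar hGS hne h12 hns hsp h15 h18 hfine W hX
      hnsj ht0 K Wd Cd hK hodd hHN hH3 hLt' hWd' hsha
  exact ⟨K, inferInstance, inferInstance, Wd, inferInstance, inferInstance, Cd, hK, hodd, by rw [hdK]; omega, hHN, hH3,
    hLt', hWd', hbsd⟩


/-- **`CornerTwistWitnessAt W` from one certified row `(E, d, Wd, Cd)` on the Tamagawa cells (`t ≥ 1`)**: as
`cornerTwistWitnessAt_of_certifiedTwin`, with the t0 binder replaced by the analytic `μ = 0` certificate AT THE TWIN in the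
engine's own shape (`hAn`: for the newform of `Wd` and its canonical multiplicative `3`-adic L-function scaled to the Néron period,
some coefficient is a `3`-adic unit — kit OMS certificate, ATTESTED). ENGINE: g4's `bsdp_twin_of_muAn_of_shaAn_unit` (p561944).
KERNEL ∕ ATTESTED split otherwise as in the t0 master. CONDITIONAL on every binder; nothing booked.
[cite: Miller2011LMS, Def. 1.1] [cite: Kato2004Asterisque, §17.13 (pp. 279–280)] [cite: Wuthrich2014, Cor. 18 (p. 398)]
[cite: Marcus2018, Ch. 3 Thm. 25] -/
theorem cornerTwistWitnessAt_of_certifiedTwin_of_muAn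
    (hJs : thm61_splitMultiplicative) (hJn : thm61_nonsplitMultiplicative)
    (hGZK : rank_eq_analyticRank_of_analyticRank_le_one) (hmod : hasEntireLFunction_rat)
    (hpar : nonempty_modularParametrizationData)
    (hGS : ∀ (W : WeierstrassCurve ℚ) [W.IsElliptic] [W.IsGloballyMinimal] (p : ℕ) [Fact p.Prime],
      greenberg_stevens (W := W) (p := p))
    (hne : Kato2004.nonempty_iwasawaH1Data) (h12 : Kato2004.thm12_4)
    (hns : Kato2004.exists_multDivisibilityInputs_nonsplit)
    (hsp : Kato2004.exists_multDivisibilityInputs_split)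
    (h15 : thm15_isTorsion_multiplicative_rat)
    (h18 : Wuthrich2014.corollary18_padicLFunction_mem_iwasawaAlgebra_multiplicative)
    (hfine : Kato2004.exists_multDivisibilityInputs_fine)
    (W : WeierstrassCurve ℚ) [W.IsElliptic] [W.IsGloballyMinimal]
    {d Δ₀ : ℤ} (hd4 : d % 4 = 1) (hsf : Squarefree d) (hlt : d < -4) (hΔ : W.Δ = (Δ₀ : ℚ))
    (hH : ∀ p : ℕ, p.Prime → p ∣ Δ₀.natAbs → (p = 2 → d % 8 = 1) ∧ (p ≠ 2 → jacobiSym d p = 1))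
    (h3 : jacobiSym d 3 = 1)
    (Wd : WeierstrassCurve ℚ) [Wd.IsElliptic] [Wd.IsGloballyMinimal] (Cd : VariableChange ℚ)
    (hWd : Cd • W.quadraticTwist (d : ℚ) = Wd)
    (hLt : (W.quadraticTwist (d : ℚ)).entireLFunction 1 ≠ 0)
    (hsha : ∃ q : ℚ, q ≠ 0 ∧ shaAn Wd = (q : ℂ) ∧ padicValRat 3 q = 0)
    -- attested analytic μ = 0 certificate at the twin (engine shape)
    (hAn : ∀ {N : ℕ} [NeZero N] (f : CuspForm (CongruenceSubgroup.Gamma0 N) 2), IsNewformOf Wd f →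
      ∀ (ϖ : ℚ), (ϖ : ℝ) * Wd.realPeriodRat = plusPeriod f →
      ∀ (a : ℚ_[3]) (L : PowerSeries ℚ_[3]),
        (Wd.HasSplitMultiplicativeReductionAtPrime 3 → a = 1) →
        (¬ Wd.HasSplitMultiplicativeReductionAtPrime 3 → a = -1) →
        IsMultPAdicLFunctionOf f 3 a L →
        ∃ n : ℕ, ‖PowerSeries.coeff n (PowerSeries.C ((ϖ : ℚ) : ℚ_[3]) * L)‖ = 1) :
    CornerTwistWitnessAt W := by
  intro hX hnsj
  obtain ⟨K, _, _, h2, hdK⟩ :=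
    Literature.NumberTheory.QuadraticFields.Quadratic.exists_numberField_discr_eq (D := d)
      (Or.inl ⟨hd4, hsf, by omega⟩)
  have hK : IsImaginaryQuadratic K :=
    ⟨h2, Literature.NumberTheory.QuadraticFields.Quadratic.isTotallyComplex_of_discr_neg h2 (by rw [hdK]; omega)⟩
  have hodd : Odd (NumberField.discr K) := by
    rw [hdK, Int.odd_iff]; omega
  have hHN : SatisfiesHeegnerHypothesis (W.conductorNorm ℤ) K :=
    satisfiesHeegnerHypothesis_conductorNorm_of_kronecker W K h2 hdK hΔ hH
  have hH3 : SatisfiesHeegnerHypothesis 3 K := satisfiesHeegnerHypothesis_three_of_kronecker K h2 hdK h3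
  have hdq : (NumberField.discr K : ℚ) = (d : ℚ) := by exact_mod_cast hdK
  have hLt' : (W.quadraticTwist (NumberField.discr K : ℚ)).entireLFunction 1 ≠ 0 := by rw [hdq]; exact hLt
  have hWd' : Cd • W.quadraticTwist (NumberField.discr K : ℚ) = Wd := by rw [hdq]; exact hWd
  have hbsd : BSDp Wd 3 :=
    bsdp_twin_of_muAn_of_shaAn_unit hJs hJn hGZK hmod hpar hGS hne h12 hns hsp h15 h18 hfine W hX hnsj K Wd Cd hK hHN
      hLt' hWd' hsha hAn
  exact ⟨K, inferInstance, inferInstance, Wd, inferInstance, inferInstance, Cd, hK, hodd, by rw [hdK]; omega, hHN, hH3,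
    hLt', hWd', hbsd⟩

/-! ## §2 Two rungs (census rows of kit j289339–j289345; t0 cell; the companion `…RungRows01` has five more) -/

/-- **BC5 rung at Cremona `726a1`** (N = 726 = 2 · 3 · 11^2; image type `Ns` at `3`; t0 cell `3 ∤ ∏c = 4`):
the EXACT odd Heegner twin `d = -95` — census row (kit j289043): `#Ш_an(E^d) = 1`, `∏_ℓ c_ℓ(E^d) = 16`,
`#E^d(ℚ)_tors = 2`, `L(E^d,1)/Ω⁺ = 4` (engines 1 ∕ 2a agree). KERNEL: `Δ(W) = 2299968` (primes 2, 3, 11),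
the Kronecker symbols `(-95/p) = 1` at those primes and at `3`, `d ≡ 1 (mod 4)` squarefree, the field `ℚ(√-95)`, and the twist identity
`Cd • W.quadraticTwist -95 = Wd` with `Cd = (u,r,s,t) = (1,40,1/2,0)`, `Wd = ⟨1, 1, 0, -320575, 30965125⟩` (Tate ∕ PARI `ellminimalmodel`). ATTESTED: `L(E^d,1) ≠ 0`,
`#Ш_an(Wd) = 1`, `3 ∤ ∏c(E)`, global minimality. One curve; closes nothing. [cite: Miller2011LMS, Def. 1.1] -/
theorem cornerTwistWitnessAt_726a1
    (hF : thm61_splitMultiplicative ∧ thm61_nonsplitMultiplicative ∧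
      rank_eq_analyticRank_of_analyticRank_le_one ∧ WeierstrassCurve.hasEntireLFunction_rat ∧
      nonempty_modularParametrizationData ∧
      (∀ (W : WeierstrassCurve ℚ) [W.IsElliptic] [W.IsGloballyMinimal] (p : ℕ) [Fact p.Prime],
        greenberg_stevens (W := W) (p := p)) ∧
      Kato2004.nonempty_iwasawaH1Data ∧ Kato2004.thm12_4 ∧
      Kato2004.exists_multDivisibilityInputs_nonsplit ∧ Kato2004.exists_multDivisibilityInputs_split ∧
      thm15_isTorsion_multiplicative_rat ∧
      Wuthrich2014.corollary18_padicLFunction_mem_iwasawaAlgebra_multiplicative ∧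
      Kato2004.exists_multDivisibilityInputs_fine)
    (W : WeierstrassCurve ℚ) (hW : W = ⟨1, 1, 0, -35, -51⟩) [W.IsElliptic] [W.IsGloballyMinimal]
    (Wd : WeierstrassCurve ℚ) (hWd : Wd = ⟨1, 1, 0, -320575, 30965125⟩) [Wd.IsElliptic] [Wd.IsGloballyMinimal]
    (ht0 : ¬ 3 ∣ W.tamagawaProduct)
    (hLt : (W.quadraticTwist ((-95 : ℤ) : ℚ)).entireLFunction 1 ≠ 0) (hsha : shaAn Wd = ((1 : ℕ) : ℂ)) :
    CornerTwistWitnessAt W := by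
  obtain ⟨hJs, hJn, hGZK, hmod, hpar, hGS, hne, h12, hns, hsp, h15, h18, hfine⟩ := hF
  exact cornerTwistWitnessAt_of_certifiedTwin hJs hJn hGZK hmod hpar hGS hne h12 hns hsp h15 h18 hfine W
    (d := -95) (Δ₀ := 2299968) (by decide) (Int.squarefree_natAbs.mp (by rw [Int.natAbs_neg]; exact (show Squarefree ((5 : ℕ) * (19)) from Nat.squarefree_mul_iff.mpr ⟨by norm_num, (by norm_num : Nat.Prime 5).prime.squarefree, (show Squarefree (19 : ℕ) from (by norm_num : Nat.Prime 19).prime.squarefree)⟩))) (by decide)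
    (by subst hW; norm_num [WeierstrassCurve.Δ, WeierstrassCurve.b₂, WeierstrassCurve.b₄, WeierstrassCurve.b₆,
      WeierstrassCurve.b₈])
    (by
      intro p hp hpd
      have hn : (2299968 : ℤ).natAbs = 2 ^ 6 * 3 ^ 3 * 11 ^ 3 := by norm_num
      rw [hn] at hpd
      simp only [hp.dvd_mul, hp.prime.dvd_pow_iff_dvd, Nat.prime_dvd_prime_iff_eq hp (show Nat.Prime 2 by norm_num), Nat.prime_dvd_prime_iff_eq hp (show Nat.Prime 3 by norm_num), Nat.prime_dvd_prime_iff_eq hp (show Nat.Prime 11 by norm_num), ne_eq, OfNat.ofNat_ne_zero, not_false_eq_true] at hpd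
      rcases hpd with ((rfl | rfl) | rfl) <;> constructor <;> intro h <;> first | exact absurd h (by decide) | norm_num)
    (by norm_num)
    ht0 Wd ⟨1, 40, (1/2 : ℚ), 0⟩
    (by
      subst hW; subst hWd
      ext <;> simp only [variableChange_a₁, variableChange_a₂, variableChange_a₃, variableChange_a₄, variableChange_a₆,
        quadraticTwist_a₁, quadraticTwist_a₂, quadraticTwist_a₃, quadraticTwist_a₄, quadraticTwist_a₆,
        WeierstrassCurve.b₂, WeierstrassCurve.b₄, WeierstrassCurve.b₆] <;> push_cast <;> norm_num)
    (by exact_mod_cast hLt) (shaAn_cert_of_eq_nat Wd (by norm_num) (by norm_num) hsha)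

/-- **BC5 rung at Cremona `4704w1`** (N = 4704 = 2^5 · 3 · 7^2; image type `Nn` at `3`; t0 cell `3 ∤ ∏c = 4`):
the EXACT odd Heegner twin `d = -47` — census row (kit j289043): `#Ш_an(E^d) = 1`, `∏_ℓ c_ℓ(E^d) = 16`,
`#E^d(ℚ)_tors = 2`, `L(E^d,1)/Ω⁺ = 4` (engines 1 ∕ 2a agree). KERNEL: `Δ(W) = 592704` (primes 2, 3, 7),
the Kronecker symbols `(-47/p) = 1` at those primes and at `3`, `d ≡ 1 (mod 4)` squarefree, the field `ℚ(√-47)`, and the twist identity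
`Cd • W.quadraticTwist -47 = Wd` with `Cd = (u,r,s,t) = (1,-16,0,0)`, `Wd = ⟨0, -1, 0, -561822, 162228060⟩` (Tate ∕ PARI `ellminimalmodel`). ATTESTED: `L(E^d,1) ≠ 0`,
`#Ш_an(Wd) = 1`, `3 ∤ ∏c(E)`, global minimality. One curve; closes nothing. [cite: Miller2011LMS, Def. 1.1] -/
theorem cornerTwistWitnessAt_4704w1
    (hF : thm61_splitMultiplicative ∧ thm61_nonsplitMultiplicative ∧
      rank_eq_analyticRank_of_analyticRank_le_one ∧ WeierstrassCurve.hasEntireLFunction_rat ∧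
      nonempty_modularParametrizationData ∧
      (∀ (W : WeierstrassCurve ℚ) [W.IsElliptic] [W.IsGloballyMinimal] (p : ℕ) [Fact p.Prime],
        greenberg_stevens (W := W) (p := p)) ∧
      Kato2004.nonempty_iwasawaH1Data ∧ Kato2004.thm12_4 ∧
      Kato2004.exists_multDivisibilityInputs_nonsplit ∧ Kato2004.exists_multDivisibilityInputs_split ∧
      thm15_isTorsion_multiplicative_rat ∧
      Wuthrich2014.corollary18_padicLFunction_mem_iwasawaAlgebra_multiplicative ∧
      Kato2004.exists_multDivisibilityInputs_fine)
    (W : WeierstrassCurve ℚ) (hW : W = ⟨0, -1, 0, -254, -1476⟩) [W.IsElliptic] [W.IsGloballyMinimal]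
    (Wd : WeierstrassCurve ℚ) (hWd : Wd = ⟨0, -1, 0, -561822, 162228060⟩) [Wd.IsElliptic] [Wd.IsGloballyMinimal]
    (ht0 : ¬ 3 ∣ W.tamagawaProduct)
    (hLt : (W.quadraticTwist ((-47 : ℤ) : ℚ)).entireLFunction 1 ≠ 0) (hsha : shaAn Wd = ((1 : ℕ) : ℂ)) :
    CornerTwistWitnessAt W := by
  obtain ⟨hJs, hJn, hGZK, hmod, hpar, hGS, hne, h12, hns, hsp, h15, h18, hfine⟩ := hF
  exact cornerTwistWitnessAt_of_certifiedTwin hJs hJn hGZK hmod hpar hGS hne h12 hns hsp h15 h18 hfine W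
    (d := -47) (Δ₀ := 592704) (by decide) (Int.squarefree_natAbs.mp (by rw [Int.natAbs_neg]; exact (show Squarefree (47 : ℕ) from (by norm_num : Nat.Prime 47).prime.squarefree))) (by decide)
    (by subst hW; norm_num [WeierstrassCurve.Δ, WeierstrassCurve.b₂, WeierstrassCurve.b₄, WeierstrassCurve.b₆,
      WeierstrassCurve.b₈])
    (by
      intro p hp hpd
      have hn : (592704 : ℤ).natAbs = 2 ^ 6 * 3 ^ 3 * 7 ^ 3 := by norm_num
      rw [hn] at hpd
      simp only [hp.dvd_mul, hp.prime.dvd_pow_iff_dvd, Nat.prime_dvd_prime_iff_eq hp (show Nat.Prime 2 by norm_num), Nat.prime_dvd_prime_iff_eq hp (show Nat.Prime 3 by norm_num), Nat.prime_dvd_prime_iff_eq hp (show Nat.Prime 7 by norm_num), ne_eq, OfNat.ofNat_ne_zero, not_false_eq_true] at hpd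
      rcases hpd with ((rfl | rfl) | rfl) <;> constructor <;> intro h <;> first | exact absurd h (by decide) | norm_num)
    (by norm_num)
    ht0 Wd ⟨1, (-16 : ℚ), 0, 0⟩
    (by
      subst hW; subst hWd
      ext <;> simp only [variableChange_a₁, variableChange_a₂, variableChange_a₃, variableChange_a₄, variableChange_a₆,
        quadraticTwist_a₁, quadraticTwist_a₂, quadraticTwist_a₃, quadraticTwist_a₄, quadraticTwist_a₆,
        WeierstrassCurve.b₂, WeierstrassCurve.b₄, WeierstrassCurve.b₆] <;> push_cast <;> norm_num)
    (by exact_mod_cast hLt) (shaAn_cert_of_eq_nat Wd (by norm_num) (by norm_num) hsha)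


end Summit.BirchSwinnertonDyer.BirchSwinnertonDyer.Theorems.CornerTwistWitness
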